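import Literature.AnabelianGeometry.EtaleTheta.BiKummerThm44SubProofs

/-!
# [EtTh] Theorem 4.4 (ii), last clause: `Ψ` carries data of base-Frobenius type and `N`-th roots of
# fraction-pairs (sub-DAG rows T44-L04b, T44-L14) — proof-only companion

S. Mochizuki, *The étale theta function …*, Publ. RIMS **45** (2009) [MochizukiEtTh2009], §4, Thm 4.4 (ii)
last sentence (PDF p.94) and its proof (PDF p.95 ll.12–16; used again at l.19 for (iv)): "`Ψ` maps `N`-th
roots of fraction-pairs with domain isomorphic to `A_{⊙,1}` to `N`-th roots of fraction-pairs with domain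
isomorphic to `A_{⊙,2}`".  Proof-only companion of `BiKummerThm44Sub.lean` / `BiKummerThm44SubProofs.lean`
(`plan/L2/SUBDAG-EtTh-Thm44.md`):
* `preservesBaseFrobeniusTypeData_of` — T44-L04b (the data `(G, α', α'')` "of base-Frobenius type",
  Def 4.1 (iv), transported field by field) ⇐ T44-L03 + T44-L04 + T44-L05 + T44-L09c + "`Ψ` preserves `O^×(−)`"
  ([FrdI] Thm 3.4 (iv), hypothesis `hU`); the bijection `G ≅ Gal(A^bs/B^bs)` is transported through `Ψ^bs`
  (`transportBaseAut_mem_galOver_iff`), `μ_N`-saturation through the group isomorphism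
  `Aut_{C₁}(A) ≅ Aut_{C₂}(Ψ A)` (`isMuSaturated_map`).
* `preservesNthRoots_of` — T44-L14 ⇐ `Thm44_ii` (the fraction-pair of the root), T44-L03 (isometries,
  Frobenius degrees), T44-L04b, T44-L08 + T44-L15a + T44-L15 (⇒) (saturation of the `N`-domain) and the
  compatibility of `Ψ^birat` with the pull-backs `((α')^birat)^*` (hypothesis `hpull`; `pullFrac` is the free
  parameter of `NthRoot`, [FrdI] Prop 1.11 (iv)).
HONEST FRAMING: refereed pre-IUT material; nothing here bears on [IUTchIII] Cor. 3.12; typed ≠ proved — the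
named INPUT sub-nodes remain hypotheses.
-/

namespace Literature.AnabelianGeometry.EtaleTheta

open CategoryTheory Opposite Literature.AlgebraicGeometry.Frobenioids

namespace BiKummerSetting

universe u₀ v₀ u v w

variable {K : Type u₀} [Field K] {K' : Type u₀} [Field K'] {D₀ : Type u₀} [Category.{v₀} D₀]
  {V : FrdIMonoidStub.{w}}
  {X₁ : SemiGraphs.TemperedArithmeticGroup.{u₀} K} {X₂ : SemiGraphs.TemperedArithmeticGroup.{u₀} K'}
  {D₀' : Type u₀} [Category.{v₀} D₀']
  {T₁ : RealifiedDivisorMonoids (D₀ := D₀) V} {T₂ : RealifiedDivisorMonoids (D₀ := D₀') V}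
  {D₁ D₂ : Type u} [Category.{v} D₁] [Category.{v} D₂] {VD₁ : FrdICatStub.{u, v, w} D₁}
  {VD₂ : FrdICatStub.{u, v, w} D₂} {S₁ : BiKummerSetting X₁ T₁ D₁ VD₁} {S₂ : BiKummerSetting X₂ T₂ D₂ VD₂}

/-! ### `Gal(A^bs/B^bs)` and `μ_N` under `Ψ` -/

/-- `Ψ^bs`-transport identifies `Gal(A^bs/B^bs)` with `Gal((Ψ A)^bs/(Ψ B)^bs)` (Def 4.1 (iv)(b)).
[cite: MochizukiEtTh2009, Thm 4.4 p.95] -/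
theorem Thm44Hyp.transportBaseAut_mem_galOver_iff (h : Thm44Hyp S₁ S₂) {A B : S₁.C} (α : A ⟶ B)
    (β : Aut (S₁.base.obj A)) :
    h.transportBaseAut A β ∈ S₂.galOver (h.Ψ.functor.map α) ↔ β ∈ S₁.galOver α := by
  show ((h.cmp A).inv ≫ h.Ψbs.functor.map β.hom ≫ (h.cmp A).hom) ≫ S₂.base.map (h.Ψ.functor.map α) =
      S₂.base.map (h.Ψ.functor.map α) ↔ β.hom ≫ S₁.base.map α = S₁.base.map α
  rw [h.base_map_Ψ_cmp, Category.assoc, Category.assoc, Iso.hom_inv_id_assoc,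
    ← h.Ψbs.functor.map_comp_assoc]
  constructor
  · intro e
    exact h.Ψbs.functor.map_injective ((cancel_mono _).1 ((cancel_epi _).1 e))
  · intro e
    rw [e]

/-- The transport `Aut_{D₁}(A^bs) → Aut_{D₂}((Ψ A)^bs)` is surjective (`Ψ^bs` is full).
[cite: MochizukiEtTh2009, Thm 4.4 p.94] -/
theorem Thm44Hyp.transportBaseAut_surjective (h : Thm44Hyp S₁ S₂) (A : S₁.C) :
    Function.Surjective (h.transportBaseAut A) := by
  intro γ
  refine ⟨h.Ψbs.functor.preimageIso ((Aut.autMulEquivOfIso (h.cmp A)).symm γ), ?_⟩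
  show (Aut.autMulEquivOfIso (h.cmp A))
      (h.Ψbs.functor.mapIso (h.Ψbs.functor.preimageIso ((Aut.autMulEquivOfIso (h.cmp A)).symm γ))) = γ
  rw [show h.Ψbs.functor.mapIso (h.Ψbs.functor.preimageIso ((Aut.autMulEquivOfIso (h.cmp A)).symm γ)) =
      (Aut.autMulEquivOfIso (h.cmp A)).symm γ from Iso.ext (h.Ψbs.functor.map_preimage _)]
  exact (Aut.autMulEquivOfIso (h.cmp A)).apply_symm_apply γ

/-- `Ψ` is injective on automorphisms (faithful). [cite: MochizukiEtTh2009, Thm 4.4 p.94] -/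
theorem Thm44Hyp.mapAut_injective (h : Thm44Hyp S₁ S₂) (A : S₁.C) :
    Function.Injective (h.Ψ.functor.mapAut A) :=
  fun _ _ e => Aut.ext (h.Ψ.functor.map_injective (congrArg Iso.hom e))

/-- Under "`Ψ` preserves `O^×(−)`" ([FrdI] Thm 3.4 (iv)): `Ψ(σ) ∈ μ_N(Ψ A) ↔ σ ∈ μ_N(A)`.
[cite: MochizukiEtTh2009, Thm 4.4 p.95] -/
theorem Thm44Hyp.mapAut_mem_mu_iff (h : Thm44Hyp S₁ S₂)
    (hU : ∀ A : S₁.C, (S₁.units A).map (h.Ψ.functor.mapAut A) = S₂.units (h.Ψ.functor.obj A))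
    {A : S₁.C} (N : ℕ+) (σ : Aut A) :
    h.Ψ.functor.mapAut A σ ∈ S₂.mu (h.Ψ.functor.obj A) N ↔ σ ∈ S₁.mu A N := by
  have hu : h.Ψ.functor.mapAut A σ ∈ S₂.units (h.Ψ.functor.obj A) ↔ σ ∈ S₁.units A := by
    rw [← hU A]
    constructor
    · intro hσ
      obtain ⟨τ, hτ, e⟩ := Subgroup.mem_map.1 hσ
      rwa [← h.mapAut_injective A e]
    · exact Subgroup.mem_map_of_mem _
  have hp : h.Ψ.functor.mapAut A σ ^ (N : ℕ) = 1 ↔ σ ^ (N : ℕ) = 1 := by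
    rw [← map_pow]
    constructor
    · intro e
      exact h.mapAut_injective A (e.trans (map_one _).symm)
    · intro e
      rw [e, map_one]
  exact and_congr hu hp

/-- `μ_N`-saturation ([FrdII] Def 2.1 (i)) is transported by `Ψ` under "`Ψ` preserves `O^×(−)`".
[cite: MochizukiEtTh2009, Thm 4.4 p.95] -/
theorem Thm44Hyp.isMuSaturated_map (h : Thm44Hyp S₁ S₂)
    (hU : ∀ A : S₁.C, (S₁.units A).map (h.Ψ.functor.mapAut A) = S₂.units (h.Ψ.functor.obj A))
    {A : S₁.C} {N : ℕ+} (hA : S₁.IsMuSaturated A N) : S₂.IsMuSaturated (h.Ψ.functor.obj A) N := by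
  obtain ⟨σ, hσ, hord, hgen⟩ := hA
  refine ⟨h.Ψ.functor.mapAut A σ, (h.mapAut_mem_mu_iff hU N σ).2 hσ, ?_, fun τ' hτ' => ?_⟩
  · rw [orderOf_injective _ (h.mapAut_injective A), hord]
  · have hτu : τ' ∈ (S₁.units A).map (h.Ψ.functor.mapAut A) := by rw [hU A]; exact hτ'.1
    obtain ⟨τ, -, rfl⟩ := Subgroup.mem_map.1 hτu
    have hτ : τ ∈ S₁.mu A N := (h.mapAut_mem_mu_iff hU N τ).1 hτ'
    rw [← MonoidHom.map_zpowers]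
    exact Subgroup.mem_map_of_mem _ (hgen τ hτ)

/-! ### T44-L04b: data of base-Frobenius type under `Ψ` -/

/-- **T44-L04b ⇐ T44-L03 + T44-L04 + T44-L05 + T44-L09c + "`Ψ` preserves `O^×(−)`"**: the data
`(G, α', α'')` of base-Frobenius type (Def 4.1 (iv) (a)–(e)) are carried field by field by `Ψ`.
[cite: MochizukiEtTh2009, Thm 4.4 p.95] -/
theorem Thm44Hyp.preservesBaseFrobeniusTypeData_of (h : Thm44Hyp S₁ S₂) (h3 : h.PreservesFrobeniusStructure)
    (h4 : h.PreservesBaseFrobeniusPairs) (h9 : h.GaloisCompatible)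
    (hU : ∀ A : S₁.C, (S₁.units A).map (h.Ψ.functor.mapAut A) = S₂.units (h.Ψ.functor.obj A)) :
    h.PreservesBaseFrobeniusTypeData := by
  intro A B α d
  obtain ⟨hA', -⟩ := h9 A d.isGalois
  have hdeg : S₂.degFr (h.Ψ.functor.map α) = S₁.degFr α := h3.1 α
  refine ⟨{ G := d.G.map (h.Ψ.functor.mapAut A)
            G_le := ?_
            α₂ := h.Ψ.functor.map d.α₂
            α₁ := h.Ψ.functor.map d.α₁
            fac := by rw [← Functor.map_comp, d.fac]
            isFrobeniusTrivial := h.preservesFrobeniusTrivial_of h3 _ d.isFrobeniusTrivial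
            isGalois := hA'
            isMuSaturated := by rw [hdeg]; exact h.isMuSaturated_map hU d.isMuSaturated
            mapsIsomorphically := ?_
            cond_c := ⟨h.isBaseIdentity_map d.cond_c.1, h3.2.2.1 _ d.cond_c.2⟩
            cond_d := h3.2.2.2 _ d.cond_d
            cond_e := h4 d.G d.α₂ d.α₁ d.cond_e }, rfl, rfl, rfl⟩
  · intro σ' hσ'
    obtain ⟨σ, hσ, rfl⟩ := Subgroup.mem_map.1 hσ'
    have e : σ.hom ≫ α = α := d.G_le hσ
    show (h.Ψ.functor.mapIso σ).hom ≫ h.Ψ.functor.map α = h.Ψ.functor.map α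
    rw [Functor.mapIso_hom, ← Functor.map_comp, e]
  · refine Set.BijOn.mk ?_ ?_ ?_
    · intro σ' hσ'
      obtain ⟨σ, hσ, rfl⟩ := Subgroup.mem_map.1 hσ'
      show S₂.autBase _ (h.Ψ.functor.mapAut A σ) ∈ S₂.galOver (h.Ψ.functor.map α)
      rw [h.autBase_mapAut]
      exact (h.transportBaseAut_mem_galOver_iff α _).2 (d.mapsIsomorphically.mapsTo hσ)
    · intro σ₁' h₁ σ₂' h₂ heq
      obtain ⟨σ₁, hσ₁, rfl⟩ := Subgroup.mem_map.1 h₁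
      obtain ⟨σ₂, hσ₂, rfl⟩ := Subgroup.mem_map.1 h₂
      have heq' : S₂.autBase _ (h.Ψ.functor.mapAut A σ₁) = S₂.autBase _ (h.Ψ.functor.mapAut A σ₂) := heq
      rw [h.autBase_mapAut, h.autBase_mapAut] at heq'
      rw [d.mapsIsomorphically.injOn hσ₁ hσ₂ (h.transportBaseAut_injective A heq')]
    · intro γ hγ
      obtain ⟨β, rfl⟩ := h.transportBaseAut_surjective A γ
      have hβ : β ∈ S₁.galOver α := (h.transportBaseAut_mem_galOver_iff α β).1 hγ
      obtain ⟨σ, hσ, hσβ⟩ := d.mapsIsomorphically.surjOn hβ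
      refine ⟨h.Ψ.functor.mapAut A σ, Subgroup.mem_map_of_mem _ hσ, ?_⟩
      show S₂.autBase _ (h.Ψ.functor.mapAut A σ) = h.transportBaseAut A β
      rw [h.autBase_mapAut, hσβ]

/-! ### T44-L14: `N`-th roots of fraction-pairs under `Ψ` -/

/-- **T44-L14 ⇐ `Thm44_ii` + T44-L03 + T44-L04b + T44-L08 + T44-L15a + T44-L15 (⇒) + `Ψ^birat` vs
pull-backs**: the image under `Ψ` of an `N`-th root `(A_N, B_N, α, β, f_N, (s'_N, s''_N))` of a fraction-pair
is an `N`-th root of the image fraction-pair (Prop 4.2 (iii) data, field by field; the identifications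
`Ψ(A_N) ≅ A_{2,N}`, `Ψ(B_N) ≅ B_{2,N}` are identities).  The domain hypothesis "isomorphic to `A_{⊙,1}`" is not
used by the transport. [cite: MochizukiEtTh2009, Thm 4.4 p.95] -/
theorem Thm44Hyp.preservesNthRoots_of (h : Thm44Hyp S₁ S₂)
    (ψ : ∀ A : S₁.C, S₁.biratUnits A ≃* S₂.biratUnits (h.Ψ.functor.obj A))
    (pullFrac₁ : ∀ {A A' : S₁.C} (_ : A' ⟶ A), S₁.biratUnits A → S₁.biratUnits A')
    (pullFrac₂ : ∀ {A A' : S₂.C} (_ : A' ⟶ A), S₂.biratUnits A → S₂.biratUnits A')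
    (hpull : ∀ {A A' : S₁.C} (φ : A' ⟶ A) (f : S₁.biratUnits A),
      ψ A' (pullFrac₁ φ f) = pullFrac₂ (h.Ψ.functor.map φ) (ψ A f))
    (hii : Thm44_ii h ψ) (h3 : h.PreservesFrobeniusStructure) (h4b : h.PreservesBaseFrobeniusTypeData)
    (h8 : h.PreservesAmple) (h15a : h.PreservesFixedByHA ψ) (h15 : h.PreservesSaturated ψ) :
    h.PreservesNthRoots ψ pullFrac₁ pullFrac₂ := by
  intro A B f P N R Q _ hQn hQd
  obtain ⟨Q', hn', hd'⟩ := hii R.root R.pair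
  obtain ⟨d', -, -, hα₁⟩ := h4b R.α R.αData
  have hAmp : S₂.IsAmple (h.Ψ.functor.obj R.AN) := h8 _ R.isSaturated.isAmple
  have hfix : S₂.IsFixedByHA (h.Ψ.functor.obj R.AN) hAmp.isGalois (ψ R.AN (pullFrac₁ R.αData.α₁ f)) :=
    h15a _ R.isSaturated.isAmple.isGalois hAmp.isGalois _ R.isSaturated.fixed
  have hroot : ψ R.AN (pullFrac₁ R.αData.α₁ f) = pullFrac₂ d'.α₁ (ψ A f) := by rw [hpull, hα₁]
  have hsat : S₂.IsSaturated (h.Ψ.functor.obj R.AN) N (pullFrac₂ d'.α₁ (ψ A f)) := by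
    rw [← hroot]; exact h15 _ N _ hAmp hfix R.isSaturated
  refine ⟨{ AN := h.Ψ.functor.obj R.AN
            BN := h.Ψ.functor.obj R.BN
            α := h.Ψ.functor.map R.α
            β := h.Ψ.functor.map R.β
            root := ψ R.AN R.root
            pair := Q'
            comm_num := by rw [hn', hQn, ← Functor.map_comp, ← Functor.map_comp, R.comm_num]
            comm_den := by rw [hd', hQd, ← Functor.map_comp, ← Functor.map_comp, R.comm_den]
            isIsometry := ⟨h3.2.1 _ R.isIsometry.1, h3.2.1 _ R.isIsometry.2.1,
              (h3.1 _).trans R.isIsometry.2.2.1, (h3.1 _).trans R.isIsometry.2.2.2⟩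
            αData := d'
            pow_root := by rw [← map_pow, R.pow_root, hroot]
            isSaturated := hsat }, Iso.refl _, Iso.refl _, ?_, ?_, ?_, ?_⟩
  · show 𝟙 _ ≫ h.Ψ.functor.map R.pair.num ≫ 𝟙 _ = Q'.num
    rw [Category.id_comp, Category.comp_id, hn']
  · show 𝟙 _ ≫ h.Ψ.functor.map R.pair.den ≫ 𝟙 _ = Q'.den
    rw [Category.id_comp, Category.comp_id, hd']
  · exact Category.id_comp _
  · exact Category.id_comp _

/-! ### v2 (append): "`Ψ` preserves `O^×(−)`" is FORMAL here ([cf. also the existence of `Ψ^bs`], p.95 l.2) -/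

/-- **`Ψ` preserves `O^×(−)`** — the hypothesis `hU` of `preservesBaseFrobeniusTypeData_of` DISCHARGED: `O^×(A)` is
the group of base-identity (linear) automorphisms ([FrdI] Def 1.2 (ii)); base-identity automorphisms are
preserved AND reflected through `Base ∘ Ψ ≅ Ψ^bs ∘ Base` (`isBaseIdentity_map`, `isBaseIdentity_of_map`), `Ψ` is
full on automorphisms, and automorphisms are linear.  (In print this is part of [FrdI] Thm 3.4 (iv); under the
hypothesis "`Ψ` induces `Ψ^bs`" of Thm 4.4 it needs no category-theoreticity.) [cite: MochizukiEtTh2009, Thm 4.4 p.95] -/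
theorem Thm44Hyp.units_map (h : Thm44Hyp S₁ S₂) (A : S₁.C) :
    (S₁.units A).map (h.Ψ.functor.mapAut A) = S₂.units (h.Ψ.functor.obj A) := by
  ext σ'
  constructor
  · intro hσ'
    obtain ⟨σ, hσ, rfl⟩ := Subgroup.mem_map.1 hσ'
    exact ⟨h.isBaseIdentity_map hσ.1, PreFrobenioid.isLinear_of_isIso S₂.F _⟩
  · intro hσ'
    obtain ⟨σ, rfl⟩ : ∃ σ : Aut A, h.Ψ.functor.mapAut A σ = σ' :=
      ⟨h.Ψ.functor.preimageIso σ', Iso.ext (h.Ψ.functor.map_preimage σ'.hom)⟩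
    exact Subgroup.mem_map_of_mem _ ⟨h.isBaseIdentity_of_map hσ'.1, PreFrobenioid.isLinear_of_isIso S₁.F _⟩

/-- **T44-L04b ⇐ T44-L03 + T44-L04 + T44-L09c** (the `O^×`-hypothesis discharged by `units_map`).
[cite: MochizukiEtTh2009, Thm 4.4 p.95] -/
theorem Thm44Hyp.preservesBaseFrobeniusTypeData_of_inputs (h : Thm44Hyp S₁ S₂)
    (h3 : h.PreservesFrobeniusStructure) (h4 : h.PreservesBaseFrobeniusPairs) (h9 : h.GaloisCompatible) :
    h.PreservesBaseFrobeniusTypeData :=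
  h.preservesBaseFrobeniusTypeData_of h3 h4 h9 h.units_map

/-- **T44-L14 from the named inputs only**: `Ψ` maps `N`-th roots of fraction-pairs to `N`-th roots ⇐ T44-L03,
T44-L04, T44-L09c, T44-L10 (with its pull-back clause `hpull`), T44-L12, T44-L15b — every other ingredient
(`Thm44_ii`, T44-L04b, T44-L05, T44-L08, T44-L15a, T44-L15 (⇒), `O^×`) being derived.
[cite: MochizukiEtTh2009, Thm 4.4 p.95] -/
theorem Thm44Hyp.preservesNthRoots_of_inputs (h : Thm44Hyp S₁ S₂)
    (ψ : ∀ A : S₁.C, S₁.biratUnits A ≃* S₂.biratUnits (h.Ψ.functor.obj A))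
    (pullFrac₁ : ∀ {A A' : S₁.C} (_ : A' ⟶ A), S₁.biratUnits A → S₁.biratUnits A')
    (pullFrac₂ : ∀ {A A' : S₂.C} (_ : A' ⟶ A), S₂.biratUnits A → S₂.biratUnits A')
    (hpull : ∀ {A A' : S₁.C} (φ : A' ⟶ A) (f : S₁.biratUnits A),
      ψ A' (pullFrac₁ φ f) = pullFrac₂ (h.Ψ.functor.map φ) (ψ A f))
    (h3 : h.PreservesFrobeniusStructure) (h4 : h.PreservesBaseFrobeniusPairs) (h9 : h.GaloisCompatible)
    (h10 : h.BiratCompatible ψ) (h12 : h.PreservesDisjointSupports) (h15 : h.PreservesNHSaturatedBsFld) :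
    h.PreservesNthRoots ψ pullFrac₁ pullFrac₂ :=
  h.preservesNthRoots_of ψ pullFrac₁ pullFrac₂ hpull (h.thm44_ii_of_subnodes ψ h3 h10 h12) h3
    (h.preservesBaseFrobeniusTypeData_of_inputs h3 h4 h9) (h.preservesAmple_of h9)
    (h.preservesFixedByHA_of ψ h9 h10) (h.preservesSaturated_of ψ h3 h15)

end BiKummerSetting

end Literature.AnabelianGeometry.EtaleTheta
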